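import Mathlib
import Literature.AlgebraicGeometry.Resolution.AffineDomainDimension
import HarnessLib

set_option linter.dupNamespace false -- mandated namespace of this single-conjunct summit

/-!
# Generic-fibre shift: a non-maximal prime becomes maximal on a localization of finite type

Let `R` be a domain of finite type over a field `k` and `P ⊂ R` a prime ideal which is not
maximal.  Choose `t : s → R` lifting a transcendence basis `s` of `R ⧸ P` over `k`
(`#s = trdeg_k (R ⧸ P) = dim R ⧸ P =: n ≥ 1`), let `A = k[X_s]` act on `R` through `t` and let
`M ⊆ R` be the multiplicative set of the values at `t` of the non-zero polynomials of `A`.  Then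

* `M ∩ P = ∅`, because the residues of `t` modulo `P` are algebraically independent;
* `R_M` is of finite type over the rational function field `k' = Frac A = A_{A ∖ 0}`, finite type
  being preserved by localization (`RingHom.finiteType_localizationPreserves`);
* `P R_M` is maximal: a prime `Q ⊋ P` of `R` disjoint from `M` would still have the residues of
  `t` algebraically independent in `R ⧸ Q`, whence `n ≤ trdeg_k (R ⧸ Q) = dim R ⧸ Q`, while
  `dim R ⧸ Q + 1 ≤ dim R ⧸ P = n`;
* `dim R_M < dim R`: by the same count every prime `Q` of `R` disjoint from `M` has
  `dim R ⧸ Q ≥ n ≥ 1`, so is not maximal; hence every chain of primes of `R_M`, contracted to `R`,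
  extends by a maximal ideal, and `dim R_M + 1 ≤ dim R < ∞`.

The dimension theory used is `dim = trdeg` for affine domains
(`Literature.AlgebraicGeometry.Resolution.exists_ringKrullDim_eq_and_trdeg_eq`) and Mathlib's
`ringKrullDim_succ_le_of_surjective`.
-/

noncomputable section

open Cardinal Order

universe u

namespace Summit.ResolutionOfSingularities.ResolutionOfSingularities.Theorems.Picover.GenericFibreShift

open Literature.AlgebraicGeometry.Resolution

section Helpers

variable {k R : Type u} [Field k] [CommRing R] [Algebra k R]

/-- If `P < Q` are ideals with `P` prime then `dim (S ⧸ Q) + 1 ≤ dim (S ⧸ P)`: the kernel of the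
surjection `S ⧸ P → S ⧸ Q` contains a non-zero element of the domain `S ⧸ P`. -/
private theorem ringKrullDim_quotient_succ_le_of_lt {S : Type u} [CommRing S] {P Q : Ideal S}
    [P.IsPrime] (h : P < Q) : ringKrullDim (S ⧸ Q) + 1 ≤ ringKrullDim (S ⧸ P) := by
  obtain ⟨x, hxQ, hxP⟩ := SetLike.exists_of_lt h
  refine ringKrullDim_succ_le_of_surjective (Ideal.Quotient.factor h.le)
    (Ideal.Quotient.factor_surjective h.le) (r := Ideal.Quotient.mk P x) ?_ ?_
  · exact mem_nonZeroDivisors_of_ne_zero (mt Ideal.Quotient.eq_zero_iff_mem.mp hxP)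
  · rw [Ideal.Quotient.factor_mk, Ideal.Quotient.eq_zero_iff_mem]
    exact hxQ

/-- For a family `t : ι → R` and an ideal `Q`, the residues of `t` modulo `Q` are algebraically
independent over `k` iff `Q` contains no value at `t` of a non-zero polynomial over `k`. -/
private theorem algebraicIndependent_mk_iff_disjoint {ι : Type u} (t : ι → R) (Q : Ideal R) :
    AlgebraicIndependent k (fun i => Ideal.Quotient.mk Q (t i)) ↔
      Disjoint (((nonZeroDivisors (MvPolynomial ι k)).map
        (MvPolynomial.aeval (R := k) t : MvPolynomial ι k →+* R) : Submonoid R) : Set R)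
        (Q : Set R) := by
  have key : ∀ p : MvPolynomial ι k, MvPolynomial.aeval (fun i => Ideal.Quotient.mk Q (t i)) p =
      Ideal.Quotient.mk Q (MvPolynomial.aeval t p) := fun p => by
    rw [← Ideal.Quotient.mkₐ_eq_mk k, MvPolynomial.comp_aeval_apply]
  rw [algebraicIndependent_iff, Set.disjoint_left]
  constructor
  · rintro h _ ⟨p, hp, rfl⟩ hpQ
    refine nonZeroDivisors.ne_zero hp (h p ?_)
    rw [key, Ideal.Quotient.eq_zero_iff_mem]
    exact hpQ
  · intro h p hp
    by_contra hp0
    refine h (Submonoid.mem_map_of_mem _ (mem_nonZeroDivisors_of_ne_zero hp0)) ?_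
    rw [SetLike.mem_coe, ← Ideal.Quotient.eq_zero_iff_mem]
    rw [key] at hp
    exact hp

variable [Algebra.FiniteType k R]

/-- If the residues modulo a prime `Q` of a family `t : ι → R`, `#ι = n`, are algebraically
independent over `k`, then `dim (R ⧸ Q)` is a natural number `≥ n` (it equals
`trdeg_k (R ⧸ Q) ≥ #ι`). -/
private theorem exists_nat_ringKrullDim_quotient_eq {ι : Type u} {t : ι → R} {n : ℕ}
    (hn : #ι = n) (Q : Ideal R) [Q.IsPrime]
    (h : AlgebraicIndependent k (fun i => Ideal.Quotient.mk Q (t i))) :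
    ∃ m : ℕ, ringKrullDim (R ⧸ Q) = m ∧ n ≤ m := by
  obtain ⟨m, hm, htr⟩ := exists_ringKrullDim_eq_and_trdeg_eq k (R ⧸ Q)
  refine ⟨m, hm, ?_⟩
  have := h.cardinalMk_le_trdeg
  rw [htr, hn] at this
  exact_mod_cast this

end Helpers

/-- **Generic-fibre shift.** In a domain `R` of finite type over a field `k`, a non-maximal prime
`P` becomes maximal in a localization `R_M` (`M ∩ P = ∅`) which is of finite type over a field
`k'` and has `dim R_M < dim R`: take `M` = values of the non-zero polynomials over `k` at lifts of
a transcendence basis of `R ⧸ P`, and `k'` = the corresponding rational function field. -/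
theorem exists_isLocalization_isMaximal_of_not_isMaximal : ∀ (k R : Type u) [Field k] [CommRing R] [IsDomain R] [Algebra k R] [Algebra.FiniteType k R] (P : Ideal R) [P.IsPrime], ¬ P.IsMaximal → ∃ (M : Submonoid R) (_ : M ≤ P.primeCompl) (k' : Type u) (_ : Field k') (_ : Algebra k' (Localization M)), Algebra.FiniteType k' (Localization M) ∧ (P.map (algebraMap R (Localization M))).IsMaximal ∧ ringKrullDim (Localization M) < ringKrullDim R := by
  intro k R _ _ _ _ _ P _ hP
  -- a transcendence basis `s` of `R ⧸ P` over `k`, lifted to `t : s → R`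
  haveI : FaithfulSMul k (R ⧸ P) :=
    (faithfulSMul_iff_algebraMap_injective k (R ⧸ P)).mpr (algebraMap k (R ⧸ P)).injective
  obtain ⟨s, hs⟩ := exists_isTranscendenceBasis k (R ⧸ P)
  choose t ht using fun x : s => Ideal.Quotient.mk_surjective (I := P) (x : R ⧸ P)
  -- `dim (R ⧸ P) = trdeg (R ⧸ P) = #s =: n` and `dim R =: d` are finite
  obtain ⟨n, hn, htrP⟩ := exists_ringKrullDim_eq_and_trdeg_eq k (R ⧸ P)
  obtain ⟨d, hd, -⟩ := exists_ringKrullDim_eq_and_trdeg_eq k R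
  have hsn : #s = n := by rw [hs.cardinalMk_eq_trdeg, htrP]
  -- the polynomial ring `A = k[X_s]`, acting on `R` through `t`, and `M = f (A ∖ 0)`
  set A : Type u := MvPolynomial s k
  set f : A →+* R := (MvPolynomial.aeval (R := k) t : A →+* R) with hf_def
  set M : Submonoid R := (nonZeroDivisors A).map f
  have hbasis : AlgebraicIndependent k (fun i => Ideal.Quotient.mk P (t i)) := by
    have e : (fun i : s => Ideal.Quotient.mk P (t i)) = ((↑) : s → R ⧸ P) := funext ht
    rw [e]
    exact hs.1
  have hPdisj : Disjoint (M : Set R) (P : Set R) :=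
    (algebraicIndependent_mk_iff_disjoint t P).mp hbasis
  -- dimension count: a prime `Q` disjoint from `M` has `dim (R ⧸ Q) = m ≥ n`
  have hdim : ∀ (Q : Ideal R) [Q.IsPrime], Disjoint (M : Set R) (Q : Set R) →
      ∃ m : ℕ, ringKrullDim (R ⧸ Q) = m ∧ n ≤ m := fun Q _ hQ =>
    exists_nat_ringKrullDim_quotient_eq hsn Q ((algebraicIndependent_mk_iff_disjoint t Q).mpr hQ)
  -- `1 ≤ n` since `P` is not maximal
  have h1n : 1 ≤ n := by
    obtain ⟨𝔪, h𝔪, hP𝔪⟩ := Ideal.exists_le_maximal P (Ideal.IsPrime.ne_top ‹_›)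
    have hlt : P < 𝔪 := lt_of_le_of_ne hP𝔪 (fun h => hP (h ▸ h𝔪))
    have h := ringKrullDim_quotient_succ_le_of_lt hlt
    rw [hn, ringKrullDim_eq_zero_of_isField
      ((Ideal.Quotient.maximal_ideal_iff_isField_quotient 𝔪).mp h𝔪)] at h
    have h' : ((0 + 1 : ℕ) : WithBot ℕ∞) ≤ n := by exact_mod_cast h
    have h'' : 0 + 1 ≤ n := by exact_mod_cast h'
    omega
  -- hence no prime disjoint from `M` is maximal
  have hnotmax : ∀ (Q : Ideal R) [Q.IsPrime], Disjoint (M : Set R) (Q : Set R) →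
      ¬ Q.IsMaximal := by
    intro Q _ hQ hmax
    obtain ⟨m, hm, hnm⟩ := hdim Q hQ
    rw [ringKrullDim_eq_zero_of_isField
      ((Ideal.Quotient.maximal_ideal_iff_isField_quotient Q).mp hmax)] at hm
    have hm' : ((0 : ℕ) : WithBot ℕ∞) = m := by exact_mod_cast hm
    have hm'' : (0 : ℕ) = m := by exact_mod_cast hm'
    omega
  -- `R` is of finite type over `A`
  have hf : f.FiniteType := by
    apply RingHom.FiniteType.of_comp_finiteType (f := algebraMap k A)
    rw [hf_def, AlgHom.comp_algebraMap, RingHom.finiteType_algebraMap]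
    infer_instance
  have hFT := RingHom.finiteType_localizationPreserves f (nonZeroDivisors A) (FractionRing A)
    (Localization M) hf
  have hP' : (P.map (algebraMap R (Localization M))).IsPrime :=
    IsLocalization.isPrime_of_isPrime_disjoint M (Localization M) P ‹_› hPdisj
  refine ⟨M, fun m hm hmP => Set.disjoint_left.mp hPdisj hm hmP, FractionRing A, inferInstance,
    (IsLocalization.map (Localization M) f (nonZeroDivisors A).le_comap_map).toAlgebra, hFT,
    ?_, ?_⟩
  · -- `P R_M` is maximal
    by_contra hmax
    obtain ⟨𝔐, h𝔐, hle⟩ := Ideal.exists_le_maximal _ hP'.ne_top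
    have hlt : P.map (algebraMap R (Localization M)) < 𝔐 :=
      lt_of_le_of_ne hle (fun h => hmax (h ▸ h𝔐))
    haveI := h𝔐
    have hQdisj : Disjoint (M : Set R) ((𝔐.under R : Ideal R) : Set R) :=
      (IsLocalization.disjoint_under_iff M (Localization M) 𝔐).mpr h𝔐.ne_top
    have hPQ : P < 𝔐.under R := by
      refine lt_of_le_of_ne (Ideal.map_le_iff_le_comap.mp hle) (fun h => ?_)
      have h2 := IsLocalization.map_under M (Localization M) 𝔐
      rw [← h] at h2
      exact hlt.ne h2
    obtain ⟨m, hm, hnm⟩ := hdim (𝔐.under R) hQdisj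
    have h3 := ringKrullDim_quotient_succ_le_of_lt hPQ
    rw [hm, hn] at h3
    have h3' : ((m + 1 : ℕ) : WithBot ℕ∞) ≤ n := by exact_mod_cast h3
    have h3'' : m + 1 ≤ n := by exact_mod_cast h3'
    omega
  · -- `dim R_M < dim R`
    rw [hd, ringKrullDim, Order.krullDim_lt_coe_iff]
    intro l
    let F : PrimeSpectrum (Localization M) → PrimeSpectrum R :=
      fun p => ⟨p.asIdeal.under R, inferInstance⟩
    have hF : StrictMono F := by
      intro p q hpq
      rw [← PrimeSpectrum.asIdeal_lt_asIdeal] at hpq ⊢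
      exact (IsLocalization.orderEmbedding M (Localization M)).lt_iff_lt.mpr hpq
    have hQ : ¬ (F l.last).asIdeal.IsMaximal :=
      hnotmax (l.last.asIdeal.under R)
        ((IsLocalization.disjoint_under_iff M (Localization M) l.last.asIdeal).mpr
          l.last.isPrime.ne_top)
    obtain ⟨𝔪, h𝔪, hle⟩ := Ideal.exists_le_maximal _ (F l.last).isPrime.ne_top
    have hlt : F l.last < ⟨𝔪, h𝔪.isPrime⟩ := by
      rw [← PrimeSpectrum.asIdeal_lt_asIdeal]
      exact lt_of_le_of_ne hle (fun h => hQ (h ▸ h𝔪))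
    have hlen := LTSeries.length_le_krullDim ((l.map F hF).snoc ⟨𝔪, h𝔪.isPrime⟩
      (by rw [LTSeries.last_map]; exact hlt))
    change _ ≤ ringKrullDim R at hlen
    rw [hd] at hlen
    simp only [RelSeries.snoc_length, LTSeries.map_length] at hlen
    have hlen' : l.length + 1 ≤ d := by exact_mod_cast hlen
    omega

end Summit.ResolutionOfSingularities.ResolutionOfSingularities.Theorems.Picover.GenericFibreShift

end
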